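import Mathlib
import Literature.Computability.Complexity.SymmetricDnf
import Summits.PneNP.PneNP.Theorems.SymmetryBudgetWindowBarrierRelocation

/-!
# Stub `twinIso_hasSymCircuit_quasipoly` of line `bijection-gauge-twin-iso` for crux
`SymmetryBudget.WindowBarrier` (item stmt-PneNP-2145, route route-PneNP-SymmetryBudget)

**The quasi-polynomial UPPER bound calibrating the open stub `stub_twinIsoHard`.** For every `m`,
the twin-isomorphism bit `x ↦ [Gr x [A] ≅ Gr x [B]]` of an `m × m` Boolean matrix `x`
(`Gr x = SimpleGraph.fromRel (x · · = true)`; free vertices `F = {u | m ≤ u + g}`, `g = ⌊log₂ m⌋`;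
`A` = the free vertices adjacent to the ORDERED vertex `0`, `B = F ∖ A`) has a
`Bud(m,g)`-symmetric `tcBasis`-circuit with at most `2 ^ (2 (g+1)²) = m^{O(log m)}` gates (we give
`c = 2`); so the open lower bound `stub_twinIsoHard` lives in the gap `(poly(m), m^{O(log m)}]`.

Proof. (1) The bit only reads the entries `(u, v)` of `x` with each of `u`, `v` MARKED, i.e. free
or the marker `0` (`TwinIsoUB.twinIso_of_agree`: matrices agreeing there have the same marked
halves and the same induced subgraphs on them), and (2) it is `Bud(m,g)`-invariant
(`TwinIsoUB.twinIso_relabel_iff`, adapted from the line skeleton: a budget permutation fixes `0`,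
preserves freeness and is an isomorphism of the relabelled graph onto the graph). (3) Enumerate the
`K ≤ g + 1` marked vertices by `e : Fin K → Fin m` with a retraction `d` (`exists_markedEnum`) and
read the bit as a function `F y = f (y ∘ (d × d))` of the `K × K` matrix `y = x ∘ (e × e)`; `F` is
invariant under the set `Γ'` of restrictions to `Fin K` of budget permutations (which permute the
marked vertices), so the tree's SYMMETRIC DNF (`hasSymCircuit_of_invariant`, `SymmetricDnf.lean`)
is a `Γ'`-symmetric `tcBasis`-circuit for `F` with `≤ 2^{K²} + K² + 1` gates. (4) Relocate it along
the input renaming `(a, b) ↦ (e a, e b)` (the landed type-changing hard-wiring calculus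
`CoreReduction.exists_hardwire₂` / `exists_isInducedAut_hardwire₂` of `…WindowBarrierRelocation`,
with an empty prefix): every `ρ ∈ Bud(m,g)` restricts to some `π ∈ Γ'` intertwined by the wiring,
so the automorphism of the DNF over `π` lifts to one of the relocated circuit over `ρ`
(`hasSymCircuit_reloc`). (5) `2^{K²} + K² + 1 ≤ 2^{2 (g+1)²}`; `m = 0` is the symmetric DNF itself.
No definitions (kernel-only file); no `g!`-symmetrisation is needed.

References: S. Jukna, *Boolean Function Complexity* (2012), §1.1 (DNF) [Jukna2012]; M. Anderson,
A. Dawar, *On symmetric circuits and fixed-point logics*, Theory Comput. Syst. 60 (2017), §2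
(symmetric circuits, restrictions) [AndersonDawar2016].
-/

-- `Summit.PneNP.PneNP.…` duplicates `PneNP` BY DESIGN (single-problem summit).
set_option linter.dupNamespace false

namespace Summit.PneNP.PneNP.Theorems

open Literature.Computability.Complexity Literature.Computability.Complexity.GateList Filter
open scoped Classical

namespace TwinIsoUB

/-! ### The twin-isomorphism bit reads only the marked entries -/

/-- **The twin-isomorphism bit only reads the relevant entries.** If `x` and `x'` agree at every
position whose two indices are each free (`m ≤ u + ⌊log₂ m⌋`) or the marker `0`, then the graphs
`Gr x`, `Gr x'` have the same adjacency between such vertices, hence the same marked halves `A`,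
`B` and the same induced subgraphs on them, and twin isomorphism transfers from `x` to `x'`.
[folklore] -/
theorem twinIso_of_agree {m : ℕ} {x x' : Fin m × Fin m → Bool}
    (h : ∀ q : Fin m × Fin m, (m ≤ (q.1 : ℕ) + Nat.log 2 m ∨ (q.1 : ℕ) = 0) →
      (m ≤ (q.2 : ℕ) + Nat.log 2 m ∨ (q.2 : ℕ) = 0) → x q = x' q)
    (hiso : Nonempty
      (SimpleGraph.induce {u : Fin m | m ≤ (u : ℕ) + Nat.log 2 m ∧ ∃ h : 0 < m, (SimpleGraph.fromRel fun u v => x (u, v) = true).Adj ⟨0, h⟩ u}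
          (SimpleGraph.fromRel fun u v => x (u, v) = true) ≃g
        SimpleGraph.induce {u : Fin m | m ≤ (u : ℕ) + Nat.log 2 m ∧ ¬ ∃ h : 0 < m, (SimpleGraph.fromRel fun u v => x (u, v) = true).Adj ⟨0, h⟩ u}
          (SimpleGraph.fromRel fun u v => x (u, v) = true))) :
    Nonempty
      (SimpleGraph.induce {u : Fin m | m ≤ (u : ℕ) + Nat.log 2 m ∧ ∃ h : 0 < m, (SimpleGraph.fromRel fun u v => x' (u, v) = true).Adj ⟨0, h⟩ u}
          (SimpleGraph.fromRel fun u v => x' (u, v) = true) ≃g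
        SimpleGraph.induce {u : Fin m | m ≤ (u : ℕ) + Nat.log 2 m ∧ ¬ ∃ h : 0 < m, (SimpleGraph.fromRel fun u v => x' (u, v) = true).Adj ⟨0, h⟩ u}
          (SimpleGraph.fromRel fun u v => x' (u, v) = true)) := by
  -- adjacency between relevant vertices agrees
  have hadj : ∀ u v : Fin m, (m ≤ (u : ℕ) + Nat.log 2 m ∨ (u : ℕ) = 0) →
      (m ≤ (v : ℕ) + Nat.log 2 m ∨ (v : ℕ) = 0) →
        ((SimpleGraph.fromRel fun u v => x (u, v) = true).Adj u v ↔
          (SimpleGraph.fromRel fun u v => x' (u, v) = true).Adj u v) := by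
    intro u v hu hv
    rw [SimpleGraph.fromRel_adj, SimpleGraph.fromRel_adj, h (u, v) hu hv, h (v, u) hv hu]
  set G : SimpleGraph (Fin m) := SimpleGraph.fromRel fun u v => x (u, v) = true with hG
  set G' : SimpleGraph (Fin m) := SimpleGraph.fromRel fun u v => x' (u, v) = true with hG'
  -- marker adjacency of a free vertex agrees (`0` is a marker, free vertices are relevant)
  have hmark : ∀ u : Fin m, m ≤ (u : ℕ) + Nat.log 2 m →
      ((∃ h0 : 0 < m, G.Adj ⟨0, h0⟩ u) ↔ ∃ h0 : 0 < m, G'.Adj ⟨0, h0⟩ u) := fun u hu =>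
    exists_congr fun h0 => hadj ⟨0, h0⟩ u (Or.inr rfl) (Or.inl hu)
  -- the identity restricts to isomorphisms of the induced subgraphs on matching free parts
  have hsub : ∀ P P' : Fin m → Prop, (∀ u : Fin m, m ≤ (u : ℕ) + Nat.log 2 m → (P u ↔ P' u)) →
      Nonempty (G.induce {u : Fin m | m ≤ (u : ℕ) + Nat.log 2 m ∧ P u} ≃g
        G'.induce {u : Fin m | m ≤ (u : ℕ) + Nat.log 2 m ∧ P' u}) := by
    intro P P' hP
    refine ⟨{ toEquiv := Equiv.subtypeEquivRight fun u =>
                ⟨fun hu => ⟨hu.1, (hP u hu.1).1 hu.2⟩, fun hu => ⟨hu.1, (hP u hu.1).2 hu.2⟩⟩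
              map_rel_iff' := fun {a b} => ?_ }⟩
    have ha : m ≤ (a.1 : ℕ) + Nat.log 2 m ∧ P a.1 := a.2
    have hb : m ≤ (b.1 : ℕ) + Nat.log 2 m ∧ P b.1 := b.2
    exact (hadj a.1 b.1 (Or.inl ha.1) (Or.inl hb.1)).symm
  obtain ⟨eA⟩ := hsub (fun u => ∃ h0 : 0 < m, G.Adj ⟨0, h0⟩ u)
    (fun u => ∃ h0 : 0 < m, G'.Adj ⟨0, h0⟩ u) hmark
  obtain ⟨eB⟩ := hsub (fun u => ¬ ∃ h0 : 0 < m, G.Adj ⟨0, h0⟩ u)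
    (fun u => ¬ ∃ h0 : 0 < m, G'.Adj ⟨0, h0⟩ u) fun u hu => (hmark u hu).not
  obtain ⟨φ⟩ := hiso
  exact ⟨(eA.symm.trans φ).trans eB⟩

/-! ### `Bud`-invariance of the twin-isomorphism bit -/

/-- Freeness of an index (`m ≤ u + g`: `u` is one of the last `g` points) is preserved by every
`ρ ∈ Bud(m, g)` (which fixes the other points). [folklore] -/
theorem free_apply_iff {m g : ℕ} {ρ : Equiv.Perm (Fin m)} (hρ : ρ ∈ pointStabiliserBudget m g)
    (u : Fin m) : m ≤ ((ρ u : Fin m) : ℕ) + g ↔ m ≤ (u : ℕ) + g := by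
  rw [mem_pointStabiliserBudget_iff] at hρ
  refine ⟨fun h => ?_, fun h => ?_⟩ <;> by_contra hu
  · have h1 : ρ u = u := hρ u (by omega)
    rw [h1] at h
    omega
  · have h2 : ρ u = u := ρ.injective (hρ (ρ u) (by omega))
    rw [h2] at hu
    omega

/-- `Bud(m, ⌊log₂ m⌋)` fixes the marker vertex `0` (because `⌊log₂ m⌋ < m`). [folklore] -/
theorem apply_zero {m : ℕ} {ρ : Equiv.Perm (Fin m)}
    (hρ : ρ ∈ pointStabiliserBudget m (Nat.log 2 m)) (h : 0 < m) :
    ρ ⟨0, h⟩ = ⟨0, h⟩ :=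
  hρ ⟨0, h⟩ (by
    show 0 + Nat.log 2 m < m
    rw [zero_add]
    exact Nat.log_lt_self 2 (by omega))

/-- **`Bud`-invariance of twin isomorphism** (adapted from the line skeleton
`Lines/bijection_gauge_twin_iso.lean`). For `ρ ∈ Bud(m,⌊log₂ m⌋)`, the graph of `x ∘ (ρ × ρ)` has
the twin-isomorphism property iff the graph of `x` does: `ρ` fixes `0`, preserves freeness and is
an isomorphism of the two graphs, so it restricts to isomorphisms of the marked halves.
[folklore] -/
theorem twinIso_relabel_iff {m : ℕ} {ρ : Equiv.Perm (Fin m)}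
    (hρ : ρ ∈ pointStabiliserBudget m (Nat.log 2 m)) (x : Fin m × Fin m → Bool) :
    (Nonempty
      (SimpleGraph.induce {u : Fin m | m ≤ (u : ℕ) + Nat.log 2 m ∧ ∃ h : 0 < m, (SimpleGraph.fromRel fun u v => x (ρ u, ρ v) = true).Adj ⟨0, h⟩ u}
          (SimpleGraph.fromRel fun u v => x (ρ u, ρ v) = true) ≃g
        SimpleGraph.induce {u : Fin m | m ≤ (u : ℕ) + Nat.log 2 m ∧ ¬ ∃ h : 0 < m, (SimpleGraph.fromRel fun u v => x (ρ u, ρ v) = true).Adj ⟨0, h⟩ u}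
          (SimpleGraph.fromRel fun u v => x (ρ u, ρ v) = true))) ↔
      (Nonempty
      (SimpleGraph.induce {u : Fin m | m ≤ (u : ℕ) + Nat.log 2 m ∧ ∃ h : 0 < m, (SimpleGraph.fromRel fun u v => x (u, v) = true).Adj ⟨0, h⟩ u}
          (SimpleGraph.fromRel fun u v => x (u, v) = true) ≃g
        SimpleGraph.induce {u : Fin m | m ≤ (u : ℕ) + Nat.log 2 m ∧ ¬ ∃ h : 0 < m, (SimpleGraph.fromRel fun u v => x (u, v) = true).Adj ⟨0, h⟩ u}
          (SimpleGraph.fromRel fun u v => x (u, v) = true))) := by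
  -- `ρ` is an isomorphism from the graph of the relabelled matrix onto the graph of `x`
  have hrel : ∀ a b : Fin m,
      (SimpleGraph.fromRel fun u v => x (u, v) = true).Adj (ρ a) (ρ b) ↔
        (SimpleGraph.fromRel fun u v => x (ρ u, ρ v) = true).Adj a b := by
    intro a b
    simp [SimpleGraph.fromRel_adj, ρ.injective.ne_iff]
  set G' : SimpleGraph (Fin m) := SimpleGraph.fromRel fun u v => x (ρ u, ρ v) = true with hG'
  set G : SimpleGraph (Fin m) := SimpleGraph.fromRel fun u v => x (u, v) = true with hG
  let φ : G' ≃g G := { toEquiv := ρ, map_rel_iff' := fun {a b} => hrel a b }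
  have hφ : ∀ u, φ u = ρ u := fun u => rfl
  -- marker adjacency is transported by `ρ` (which fixes `0`)
  have hmark : ∀ u : Fin m, (∃ h : 0 < m, G'.Adj ⟨0, h⟩ u) ↔ ∃ h : 0 < m, G.Adj ⟨0, h⟩ (ρ u) := by
    intro u
    constructor
    · rintro ⟨h, hu⟩
      refine ⟨h, ?_⟩
      have h2 : G.Adj (φ ⟨0, h⟩) (φ u) := (φ.map_rel_iff).2 hu
      rwa [hφ, hφ, apply_zero hρ h] at h2
    · rintro ⟨h, hu⟩
      refine ⟨h, (φ.map_rel_iff).1 ?_⟩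
      rw [hφ, hφ, apply_zero hρ h]
      exact hu
  -- the two marked halves are carried onto the two marked halves
  have hhalf : ∀ P' P : Fin m → Prop, (∀ u, P' u ↔ P (ρ u)) →
      Set.BijOn φ {u : Fin m | m ≤ (u : ℕ) + Nat.log 2 m ∧ P' u}
        {u : Fin m | m ≤ (u : ℕ) + Nat.log 2 m ∧ P u} := by
    intro P' P hP
    refine ⟨?_, φ.injective.injOn, ?_⟩
    · intro u hu
      simp only [Set.mem_setOf_eq] at hu ⊢
      rw [hφ]
      exact ⟨(free_apply_iff hρ u).2 hu.1, (hP u).1 hu.2⟩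
    · intro v hv
      simp only [Set.mem_setOf_eq] at hv
      refine ⟨ρ.symm v, ?_, ?_⟩
      · simp only [Set.mem_setOf_eq]
        have h1 := free_apply_iff hρ (ρ.symm v)
        have h2 := hP (ρ.symm v)
        rw [Equiv.apply_symm_apply] at h1 h2
        exact ⟨h1.1 hv.1, h2.2 hv.2⟩
      · rw [hφ, Equiv.apply_symm_apply]
  have hA := hhalf (fun u => ∃ h : 0 < m, G'.Adj ⟨0, h⟩ u) (fun u => ∃ h, G.Adj ⟨0, h⟩ u) hmark
  have hB := hhalf (fun u => ¬ ∃ h : 0 < m, G'.Adj ⟨0, h⟩ u)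
    (fun u => ¬ ∃ h : 0 < m, G.Adj ⟨0, h⟩ u) fun u => (hmark u).not
  constructor
  · rintro ⟨f⟩
    exact ⟨((φ.induce hA).symm.trans f).trans (φ.induce hB)⟩
  · rintro ⟨f⟩
    exact ⟨(φ.induce hA).trans (f.trans (φ.induce hB).symm)⟩

/-! ### Relocating a symmetric circuit on the marked vertices -/

/-- **The marked vertices, enumerated.** For `0 < m` there are `K ≤ ⌊log₂ m⌋ + 1` marked vertices
(free, `m ≤ u + ⌊log₂ m⌋`, or the marker `0`; they inject into `Fin (⌊log₂ m⌋ + 1)` by `0 ↦ 0`,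
`u ↦ u + ⌊log₂ m⌋ + 1 - m`), an enumeration `e : Fin K → Fin m` of them and a retraction `d`.
[folklore] -/
theorem exists_markedEnum {m : ℕ} (hm : 0 < m) :
    ∃ (K : ℕ) (e : Fin K → Fin m) (d : Fin m → Fin K), K ≤ Nat.log 2 m + 1 ∧
      (∀ a, m ≤ ((e a : Fin m) : ℕ) + Nat.log 2 m ∨ ((e a : Fin m) : ℕ) = 0) ∧
      (∀ a, d (e a) = a) ∧
      ∀ u : Fin m, (m ≤ (u : ℕ) + Nat.log 2 m ∨ (u : ℕ) = 0) → e (d u) = u := by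
  let S := {u : Fin m // m ≤ (u : ℕ) + Nat.log 2 m ∨ (u : ℕ) = 0}
  -- `S` injects into `Fin (g + 1)`
  let ψ : S → Fin (Nat.log 2 m + 1) := fun u =>
    ⟨if ((u.1 : Fin m) : ℕ) = 0 then 0 else ((u.1 : Fin m) : ℕ) + Nat.log 2 m + 1 - m, by
      have := u.1.2
      split_ifs <;> omega⟩
  have hψ : Function.Injective ψ := by
    rintro ⟨u, hu⟩ ⟨v, hv⟩ h
    simp only [ψ, Fin.mk.injEq] at h
    have h1 := u.2
    have h2 := v.2
    refine Subtype.ext (Fin.ext ?_)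
    show (u : ℕ) = v
    split_ifs at h <;> omega
  have hK : Fintype.card S ≤ Nat.log 2 m + 1 := by
    simpa using Fintype.card_le_of_injective ψ hψ
  let ε : Fin (Fintype.card S) ≃ S := (Fintype.equivFin S).symm
  have h0 : m ≤ ((⟨0, hm⟩ : Fin m) : ℕ) + Nat.log 2 m ∨ ((⟨0, hm⟩ : Fin m) : ℕ) = 0 := Or.inr rfl
  refine ⟨Fintype.card S, fun a => (ε a).1,
    fun u => if h : m ≤ (u : ℕ) + Nat.log 2 m ∨ (u : ℕ) = 0 then ε.symm ⟨u, h⟩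
      else ε.symm ⟨⟨0, hm⟩, h0⟩,
    hK, fun a => (ε a).2, fun a => ?_, fun u hu => ?_⟩
  · simp only [dif_pos (ε a).2, Subtype.coe_eta, Equiv.symm_apply_apply]
  · simp only [dif_pos hu, Equiv.apply_symm_apply]

/-- **Relocating a symmetric circuit along a renaming of the vertices.** If every `ρ ∈ Γ`
restricts along `e : Fin K → Fin m` to some `π ∈ Γ'` (`e ∘ π = ρ ∘ e`), then a `Γ'`-symmetric
`tcBasis`-circuit for `F` on `K × K` matrices, rewired to read the entry `(e a, e b)` at input
`(a, b)` (the type-changing hard-wiring `CoreReduction.exists_hardwire₂` with empty prefix), is a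
`Γ`-symmetric circuit of the same size for `x ↦ F (x ∘ (e × e))`: the wiring intertwines `π × π`
with `ρ × ρ`, so automorphisms lift (`CoreReduction.exists_isInducedAut_hardwire₂`). [folklore] -/
theorem hasSymCircuit_reloc {m K s : ℕ} (e : Fin K → Fin m) (Γ : Set (Equiv.Perm (Fin m)))
    (Γ' : Set (Equiv.Perm (Fin K))) (hres : ∀ ρ ∈ Γ, ∃ π ∈ Γ', ∀ a, e (π a) = ρ (e a))
    {F : (Fin K × Fin K → Bool) → Bool} (hF : HasSymCircuit tcBasis Γ' s F)
    (f : (Fin m × Fin m → Bool) → Bool)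
    (hfF : ∀ x : Fin m × Fin m → Bool, F (fun i => x (e i.1, e i.2)) = f x) :
    HasSymCircuit tcBasis Γ s f := by
  obtain ⟨C, hCB, hCs, hCsym, hCF⟩ := hF
  have hpre : ∀ g ∈ ([] : List (Gate (Fin m × Fin m))), g.arity = 0 := fun g hg => by simp at hg
  obtain ⟨D, hDg, hDo⟩ := CoreReduction.exists_hardwire₂ ([] : List (Gate (Fin m × Fin m)))
    WF.nil C (fun i : Fin K × Fin K => (Sum.inl (e i.1, e i.2) : (Fin m × Fin m) ⊕ ℕ))
    (wiresOK_inl _ _)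
  refine ⟨D, CoreReduction.isOver_hardwire₂ [] (fun g hg => by simp at hg) C D hCB _ _ hDg, ?_,
    fun ρ hρ => ?_, fun x => ?_⟩
  · rw [CoreReduction.size_hardwire₂ [] C D _ _ hDg, List.length_nil, add_zero]
    exact hCs
  · obtain ⟨π, hπ, hπe⟩ := hres ρ hρ
    obtain ⟨σ, hσ⟩ := hCsym π hπ
    exact CoreReduction.exists_isInducedAut_hardwire₂ [] hpre C D _ (wiresOK_inl _ _) hDg hDo
      (π := fun q : Fin K × Fin K => (π q.1, π q.2))
      (π' := fun p : Fin m × Fin m => (ρ p.1, ρ p.2)) (fun q => by simp [hπe]) hσ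
  · rw [CoreReduction.eval_hardwire₂ [] C D _ (wiresOK_inl _ _) hDg hDo, hCF _]
    exact hfF x

/-- **Symmetric circuits for `Bud`-invariant functions of the marked entries** (`0 < m`): if
`f` reads only the entries between marked vertices and is `Bud(m,⌊log₂ m⌋)`-invariant, it has a
`Bud(m,⌊log₂ m⌋)`-symmetric `tcBasis`-circuit with at most `2 ^ (2 (⌊log₂ m⌋ + 1)²)` gates: with
`e`, `d` from `exists_markedEnum`, the function `F y = f (y ∘ (d × d))` of the `K × K` matrix is
invariant under the restrictions `Γ'` of budget permutations (they permute the marked vertices),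
its symmetric DNF (`hasSymCircuit_of_invariant`) has `≤ 2^{K²} + K² + 1 ≤ 2^{2 (g+1)²}` gates, and
`hasSymCircuit_reloc` carries it back to `f = F (· ∘ (e × e))`. [folklore] -/
theorem hasSymCircuit_of_marked {m : ℕ} (hm : 0 < m) (f : (Fin m × Fin m → Bool) → Bool)
    (hdep : ∀ x x' : Fin m × Fin m → Bool,
      (∀ q : Fin m × Fin m, (m ≤ (q.1 : ℕ) + Nat.log 2 m ∨ (q.1 : ℕ) = 0) →
        (m ≤ (q.2 : ℕ) + Nat.log 2 m ∨ (q.2 : ℕ) = 0) → x q = x' q) → f x = f x')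
    (hinv : ∀ ρ ∈ pointStabiliserBudget m (Nat.log 2 m), ∀ x : Fin m × Fin m → Bool,
      f (fun q : Fin m × Fin m => x (ρ q.1, ρ q.2)) = f x) :
    HasSymCircuit tcBasis (pointStabiliserBudget m (Nat.log 2 m))
      (2 ^ (2 * (Nat.log 2 m + 1) ^ 2)) f := by
  obtain ⟨K, e, d, hK, he, hde, hed⟩ := exists_markedEnum hm
  -- budget permutations permute the marked vertices
  have hmark : ∀ ρ ∈ pointStabiliserBudget m (Nat.log 2 m), ∀ u : Fin m,
      (m ≤ (u : ℕ) + Nat.log 2 m ∨ (u : ℕ) = 0) ↔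
        (m ≤ ((ρ u : Fin m) : ℕ) + Nat.log 2 m ∨ ((ρ u : Fin m) : ℕ) = 0) := by
    intro ρ hρ u
    rw [free_apply_iff hρ u]
    refine or_congr Iff.rfl ⟨fun hu => ?_, fun hu => ?_⟩
    · rw [show u = ⟨0, hm⟩ from Fin.ext hu, apply_zero hρ hm]
    · have h1 : ρ u = ρ ⟨0, hm⟩ := by rw [apply_zero hρ hm]; exact Fin.ext hu
      rw [ρ.injective h1]
  have hinj : ∀ a b : Fin K, e a = e b → a = b := fun a b h => by rw [← hde a, h, hde]
  -- the restrictions of budget permutations to the marked vertices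
  let Γ' : Set (Equiv.Perm (Fin K)) :=
    {π | ∃ ρ ∈ pointStabiliserBudget m (Nat.log 2 m), ∀ a, e (π a) = ρ (e a)}
  have hres : ∀ ρ ∈ pointStabiliserBudget m (Nat.log 2 m), ∃ π ∈ Γ', ∀ a, e (π a) = ρ (e a) := by
    intro ρ hρ
    have h1 : ∀ a, e (d (ρ (e a))) = ρ (e a) := fun a => hed _ ((hmark ρ hρ _).1 (he a))
    have h2 : ∀ a, e (d (ρ.symm (e a))) = ρ.symm (e a) := fun a =>
      hed _ ((hmark ρ hρ (ρ.symm (e a))).2 (by rw [Equiv.apply_symm_apply]; exact he a))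
    let π : Equiv.Perm (Fin K) :=
      { toFun := fun a => d (ρ (e a))
        invFun := fun a => d (ρ.symm (e a))
        left_inv := fun a => by
          show d (ρ.symm (e (d (ρ (e a))))) = a
          rw [h1, Equiv.symm_apply_apply, hde]
        right_inv := fun a => by
          show d (ρ (e (d (ρ.symm (e a))))) = a
          rw [h2, Equiv.apply_symm_apply, hde] }
    exact ⟨π, ⟨ρ, hρ, h1⟩, h1⟩
  -- `F y = f (y ∘ (d × d))` is `Γ'`-invariant
  have hFinv : ∀ π ∈ Γ', ∀ y : Fin K × Fin K → Bool,
      f (fun q => y (π (d q.1), π (d q.2))) = f (fun q => y (d q.1, d q.2)) := by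
    rintro π ⟨ρ, hρ, hπe⟩ y
    rw [← hinv ρ hρ (fun q => y (d q.1, d q.2))]
    refine hdep _ _ fun q h1 h2 => ?_
    have hd : ∀ u : Fin m, (m ≤ (u : ℕ) + Nat.log 2 m ∨ (u : ℕ) = 0) → d (ρ u) = π (d u) :=
      fun u hu => hinj _ _ (by rw [hed _ ((hmark ρ hρ u).1 hu), hπe, hed u hu])
    show y (π (d q.1), π (d q.2)) = y (d (ρ q.1), d (ρ q.2))
    rw [hd _ h1, hd _ h2]
  -- the symmetric DNF of `F` on the `K × K` matrix, relocated along `e`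
  have hD : HasSymCircuit tcBasis (pointStabiliserBudget m (Nat.log 2 m))
      (2 ^ (K * K) + K * K + 1) f :=
    hasSymCircuit_reloc e _ Γ' hres
      (hasSymCircuit_of_invariant (fun y => f fun q => y (d q.1, d q.2)) Γ' hFinv) f
      fun x => hdep _ _ fun q h1 h2 => by
        show x (e (d q.1), e (d q.2)) = x q
        rw [hed _ h1, hed _ h2]
  refine hD.mono ?_
  -- `2^(K K) + K K + 1 ≤ 2^(2 (g+1)²)` from `K ≤ g + 1`
  have hKK : K * K ≤ (Nat.log 2 m + 1) ^ 2 := by rw [sq]; exact Nat.mul_le_mul hK hK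
  have h1 := Nat.lt_two_pow_self (n := (Nat.log 2 m + 1) ^ 2)
  have h2 : 2 ^ (K * K) ≤ 2 ^ ((Nat.log 2 m + 1) ^ 2) := Nat.pow_le_pow_right (by norm_num) hKK
  have h3 : 2 ^ ((Nat.log 2 m + 1) ^ 2 + 1) ≤ 2 ^ (2 * (Nat.log 2 m + 1) ^ 2) :=
    Nat.pow_le_pow_right (by norm_num) (by
      have := Nat.one_le_pow 2 (Nat.log 2 m + 1) (Nat.succ_pos _)
      omega)
  rw [pow_succ] at h3
  omega

end TwinIsoUB

/-- **Registered stub `twinIso_hasSymCircuit_quasipoly`** (crux stmt-PneNP-2145, line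
`bijection-gauge-twin-iso`; the UPPER-bound calibration of the open stub `stub_twinIsoHard`): for
one numeric `c` (indeed `c = 2`) and EVERY `m`, the twin-isomorphism bit `x ↦ [Gr x [A] ≅ Gr x [B]]`
(`Gr x = SimpleGraph.fromRel (x · · = true)`, `A` / `B` = the free vertices `m ≤ u + ⌊log₂ m⌋`
adjacent / not adjacent to the ordered vertex `0`) has a `Bud(m,⌊log₂ m⌋)`-symmetric
`tcBasis`-circuit with at most `2 ^ (c (⌊log₂ m⌋ + 1)²) = m^{O(log m)}` gates: the bit reads only
the entries between the `≤ ⌊log₂ m⌋ + 1` marked vertices and is `Bud`-invariant, so the symmetric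
DNF on the marked block, relocated, computes it symmetrically (`TwinIsoUB.hasSymCircuit_of_marked`;
`m = 0`: the symmetric DNF itself). -/
theorem twinIso_hasSymCircuit_quasipoly :
    ∃ c : ℕ, ∀ m : ℕ,
      HasSymCircuit tcBasis (pointStabiliserBudget m (Nat.log 2 m))
        (2 ^ (c * (Nat.log 2 m + 1) ^ 2))
        (fun x : Fin m × Fin m → Bool => decide (Nonempty
          (SimpleGraph.induce {u : Fin m | m ≤ (u : ℕ) + Nat.log 2 m ∧ ∃ h : 0 < m, (SimpleGraph.fromRel fun u v => x (u, v) = true).Adj ⟨0, h⟩ u}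
              (SimpleGraph.fromRel fun u v => x (u, v) = true) ≃g
            SimpleGraph.induce {u : Fin m | m ≤ (u : ℕ) + Nat.log 2 m ∧ ¬ ∃ h : 0 < m, (SimpleGraph.fromRel fun u v => x (u, v) = true).Adj ⟨0, h⟩ u}
              (SimpleGraph.fromRel fun u v => x (u, v) = true)))) := by
  refine ⟨2, fun m => ?_⟩
  rcases Nat.eq_zero_or_pos m with rfl | hm
  · -- `m = 0`: the symmetric DNF, `2 ^ 0 + 0 + 1 ≤ 2 ^ 2` gates
    refine (hasSymCircuit_of_invariant _ _ fun ρ hρ x => ?_).mono (by simp)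
    exact decide_eq_decide.2 (TwinIsoUB.twinIso_relabel_iff hρ x)
  · refine TwinIsoUB.hasSymCircuit_of_marked hm _ (fun x x' hxx' => ?_) fun ρ hρ x => ?_
    · exact decide_eq_decide.2 ⟨TwinIsoUB.twinIso_of_agree hxx',
        TwinIsoUB.twinIso_of_agree fun q h1 h2 => (hxx' q h1 h2).symm⟩
    · exact decide_eq_decide.2 (TwinIsoUB.twinIso_relabel_iff hρ x)

end Summit.PneNP.PneNP.Theorems
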